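import Mathlib
import HarnessLib

/-!
# Taylor toolkit for a smooth compactly supported test function (pure calculus)

For `φ : ℂ → ℂ` smooth over `ℝ` with compact support we prove, with one constant `C` uniform in the
base point `m` and the step `v`:

* the third-order bound for the odd part `‖φ (m + v) - φ (m - v) - 2 Dφ(m) v‖ ≤ C ‖v‖ ^ 3`;
* the second-order bounds for the even part of the two partial derivatives
  `‖Dφ(m + v) u + Dφ(m - v) u - 2 Dφ(m) u‖ ≤ C ‖v‖ ^ 2` for `u = 1` and `u = I`.

The proof is the one-variable mean value inequality along the segment `s ↦ m ± s • v`, fed by a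
global Lipschitz bound on the second derivative `fderiv ℝ (fderiv ℝ φ)` (which is `C¹` with compact
support).  No lattice or probability enters.  The hypothesis `‖v‖ ≤ 1` of the registered statement
is not needed for the bounds and is simply carried along.
-/

noncomputable section

namespace Summit.CriticalPhenomena.CardyFormulaZ2.Theorems.WeakHolomorphy.SplitBypass

open scoped ContDiff NNReal

/-- Chain rule along the affine path `s ↦ m + s • w` for a real-differentiable map on `ℂ`.
[folklore] -/
private theorem hasDerivAt_along_add {E : Type*} [NormedAddCommGroup E] [NormedSpace ℝ E]
    {f : ℂ → E} (hf : Differentiable ℝ f) (m w : ℂ) (t : ℝ) :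
    HasDerivAt (fun s : ℝ => f (m + s • w)) (fderiv ℝ f (m + t • w) w) t := by
  have h1 : HasDerivAt (fun s : ℝ => m + s • w) w t := by
    simpa only [one_smul] using ((hasDerivAt_id' t).smul_const w).const_add m
  exact (hf (m + t • w)).hasFDerivAt.comp_hasDerivAt t h1

/-- Chain rule along the affine path `s ↦ m - s • w` for a real-differentiable map on `ℂ`.
[folklore] -/
private theorem hasDerivAt_along_sub {E : Type*} [NormedAddCommGroup E] [NormedSpace ℝ E]
    {f : ℂ → E} (hf : Differentiable ℝ f) (m w : ℂ) (t : ℝ) :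
    HasDerivAt (fun s : ℝ => f (m - s • w)) (-(fderiv ℝ f (m - t • w) w)) t := by
  have h1 : HasDerivAt (fun s : ℝ => m - s • w) (-w) t := by
    simpa only [one_smul] using ((hasDerivAt_id' t).smul_const w).const_sub m
  have h2 := (hf (m - t • w)).hasFDerivAt.comp_hasDerivAt t h1
  simpa only [map_neg, Function.comp_def] using h2

/-- **Symmetric second difference.** If the derivative of `g` is `K`-Lipschitz, then
`‖g (m + w) + g (m - w) - 2 g m‖ ≤ 2 K ‖w‖ ^ 2` (mean value inequality along `s ↦ m ± s • w`).
[folklore] -/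
private theorem norm_second_difference_le {E : Type*} [NormedAddCommGroup E] [NormedSpace ℝ E]
    {g : ℂ → E} {K : ℝ≥0} (hg : Differentiable ℝ g) (hK : LipschitzWith K (fderiv ℝ g))
    (m w : ℂ) : ‖g (m + w) + g (m - w) - (g m + g m)‖ ≤ 2 * K * ‖w‖ ^ 2 := by
  have hderiv : ∀ t : ℝ, HasDerivAt (fun s : ℝ => g (m + s • w) + g (m - s • w))
      (fderiv ℝ g (m + t • w) w + -(fderiv ℝ g (m - t • w) w)) t :=
    fun t => (hasDerivAt_along_add hg m w t).fun_add (hasDerivAt_along_sub hg m w t)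
  have hbound : ∀ t ∈ Set.Ico (0 : ℝ) 1,
      ‖fderiv ℝ g (m + t • w) w + -(fderiv ℝ g (m - t • w) w)‖ ≤ 2 * K * ‖w‖ ^ 2 := by
    intro t ht
    have ht0 : 0 ≤ t := ht.1
    have ht1 : t ≤ 1 := ht.2.le
    have h1 : ‖t • w‖ ≤ ‖w‖ := by
      rw [norm_smul, Real.norm_eq_abs, abs_of_nonneg ht0]
      exact mul_le_of_le_one_left (norm_nonneg w) ht1
    have hdist : ‖(m + t • w) - (m - t • w)‖ ≤ 2 * ‖w‖ := by
      have h2 : (m + t • w) - (m - t • w) = t • w + t • w := by abel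
      rw [h2]
      calc ‖t • w + t • w‖ ≤ ‖t • w‖ + ‖t • w‖ := norm_add_le _ _
        _ ≤ ‖w‖ + ‖w‖ := add_le_add h1 h1
        _ = 2 * ‖w‖ := by ring
    calc ‖fderiv ℝ g (m + t • w) w + -(fderiv ℝ g (m - t • w) w)‖
        = ‖(fderiv ℝ g (m + t • w) - fderiv ℝ g (m - t • w)) w‖ := by
          rw [← sub_eq_add_neg, sub_apply]
      _ ≤ ‖fderiv ℝ g (m + t • w) - fderiv ℝ g (m - t • w)‖ * ‖w‖ :=
          ContinuousLinearMap.le_opNorm _ _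
      _ ≤ (K * ‖(m + t • w) - (m - t • w)‖) * ‖w‖ :=
          mul_le_mul_of_nonneg_right (hK.norm_sub_le _ _) (norm_nonneg w)
      _ ≤ (K * (2 * ‖w‖)) * ‖w‖ :=
          mul_le_mul_of_nonneg_right (mul_le_mul_of_nonneg_left hdist (NNReal.coe_nonneg K))
            (norm_nonneg w)
      _ = 2 * K * ‖w‖ ^ 2 := by ring
  have hmv := norm_image_sub_le_of_norm_deriv_le_segment_01'
    (fun t _ => (hderiv t).hasDerivWithinAt) hbound
  simpa only [one_smul, zero_smul, add_zero, sub_zero] using hmv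

/-- **Odd part to third order.** If the symmetric second difference of `fderiv ℝ φ` is bounded by
`A ‖w‖ ^ 2` in operator norm, then `‖φ (m + v) - φ (m - v) - 2 Dφ(m) v‖ ≤ A ‖v‖ ^ 3`
(mean value inequality for `s ↦ φ (m + s • v) - φ (m - s • v) - s • 2 Dφ(m) v` on `[0, 1]`).
[folklore] -/
private theorem norm_odd_part_le {E : Type*} [NormedAddCommGroup E] [NormedSpace ℝ E]
    {φ : ℂ → E} (hφ : Differentiable ℝ φ) {A : ℝ} (hA0 : 0 ≤ A)
    (hA : ∀ m w : ℂ, ‖fderiv ℝ φ (m + w) + fderiv ℝ φ (m - w) - (fderiv ℝ φ m + fderiv ℝ φ m)‖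
      ≤ A * ‖w‖ ^ 2)
    (m v : ℂ) : ‖φ (m + v) - φ (m - v) - (fderiv ℝ φ m v + fderiv ℝ φ m v)‖ ≤ A * ‖v‖ ^ 3 := by
  have hderiv : ∀ t : ℝ, HasDerivAt
      (fun s : ℝ => φ (m + s • v) - φ (m - s • v) - s • (fderiv ℝ φ m v + fderiv ℝ φ m v))
      (fderiv ℝ φ (m + t • v) v - -(fderiv ℝ φ (m - t • v) v)
        - (1 : ℝ) • (fderiv ℝ φ m v + fderiv ℝ φ m v)) t :=
    fun t => ((hasDerivAt_along_add hφ m v t).fun_sub (hasDerivAt_along_sub hφ m v t)).fun_sub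
      ((hasDerivAt_id' t).smul_const _)
  have hbound : ∀ t ∈ Set.Ico (0 : ℝ) 1,
      ‖fderiv ℝ φ (m + t • v) v - -(fderiv ℝ φ (m - t • v) v)
        - (1 : ℝ) • (fderiv ℝ φ m v + fderiv ℝ φ m v)‖ ≤ A * ‖v‖ ^ 3 := by
    intro t ht
    have ht0 : 0 ≤ t := ht.1
    have ht1 : t ≤ 1 := ht.2.le
    have heq : fderiv ℝ φ (m + t • v) v - -(fderiv ℝ φ (m - t • v) v)
        - (1 : ℝ) • (fderiv ℝ φ m v + fderiv ℝ φ m v) =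
        (fderiv ℝ φ (m + t • v) + fderiv ℝ φ (m - t • v) - (fderiv ℝ φ m + fderiv ℝ φ m)) v := by
      simp only [sub_apply, add_apply, one_smul, sub_neg_eq_add]
    have h1 : ‖t • v‖ ≤ ‖v‖ := by
      rw [norm_smul, Real.norm_eq_abs, abs_of_nonneg ht0]
      exact mul_le_of_le_one_left (norm_nonneg v) ht1
    rw [heq]
    calc ‖(fderiv ℝ φ (m + t • v) + fderiv ℝ φ (m - t • v) - (fderiv ℝ φ m + fderiv ℝ φ m)) v‖
        ≤ ‖fderiv ℝ φ (m + t • v) + fderiv ℝ φ (m - t • v) - (fderiv ℝ φ m + fderiv ℝ φ m)‖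
            * ‖v‖ := ContinuousLinearMap.le_opNorm _ _
      _ ≤ (A * ‖t • v‖ ^ 2) * ‖v‖ := mul_le_mul_of_nonneg_right (hA m (t • v)) (norm_nonneg v)
      _ ≤ (A * ‖v‖ ^ 2) * ‖v‖ :=
          mul_le_mul_of_nonneg_right
            (mul_le_mul_of_nonneg_left (pow_le_pow_left₀ (norm_nonneg _) h1 2) hA0) (norm_nonneg v)
      _ = A * ‖v‖ ^ 3 := by ring
  have hmv := norm_image_sub_le_of_norm_deriv_le_segment_01'
    (fun t _ => (hderiv t).hasDerivWithinAt) hbound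
  simpa only [one_smul, zero_smul, add_zero, sub_zero, sub_self] using hmv

/-- From an operator-norm bound on `L₁ + L₂ - 2 L₃` to the bound on a unit-size vector `u`, in the
`2 * L₃ u` form of the registered statement. [folklore] -/
private theorem norm_apply_le_of_opNorm_le {L₁ L₂ L₃ : ℂ →L[ℝ] ℂ} {B : ℝ}
    (h : ‖L₁ + L₂ - (L₃ + L₃)‖ ≤ B) (hB : 0 ≤ B) (u : ℂ) (hu : ‖u‖ ≤ 1) :
    ‖L₁ u + L₂ u - 2 * L₃ u‖ ≤ B := by
  have heq : L₁ u + L₂ u - 2 * L₃ u = (L₁ + L₂ - (L₃ + L₃)) u := by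
    simp only [sub_apply, add_apply, two_mul]
  rw [heq]
  calc ‖(L₁ + L₂ - (L₃ + L₃)) u‖ ≤ ‖L₁ + L₂ - (L₃ + L₃)‖ * ‖u‖ :=
        ContinuousLinearMap.le_opNorm _ _
    _ ≤ B * 1 := mul_le_mul h hu (norm_nonneg _) hB
    _ = B := mul_one B

/-- **`stub_calculus` — the Taylor toolkit for a test function (pure calculus).** For a smooth,
compactly supported `φ : ℂ → ℂ` there is one constant `C` such that, uniformly in the base point
`m` and the step `v` with `‖v‖ ≤ 1`: the odd part `φ (m + v) - φ (m - v) - 2 Dφ(m) v` is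
`≤ C ‖v‖ ^ 3`, and the even parts of the two partial derivatives
`Dφ(m + v) u + Dφ(m - v) u - 2 Dφ(m) u`, `u = 1, I`, are `≤ C ‖v‖ ^ 2`.  Proof: `C = 2 K` where
`K` is a global Lipschitz constant of `fderiv ℝ (fderiv ℝ φ)` (a `C¹` map with compact support),
via the mean value inequality along segments. [folklore] -/
theorem stub_calculus : ∀ (φ : ℂ → ℂ), ContDiff ℝ (⊤ : ℕ∞) φ → HasCompactSupport φ →
    ∃ C : ℝ, ∀ (m v : ℂ), ‖v‖ ≤ 1 →
      ‖φ (m + v) - φ (m - v) - 2 * fderiv ℝ φ m v‖ ≤ C * ‖v‖ ^ 3 ∧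
      ‖fderiv ℝ φ (m + v) 1 + fderiv ℝ φ (m - v) 1 - 2 * fderiv ℝ φ m 1‖ ≤ C * ‖v‖ ^ 2 ∧
      ‖fderiv ℝ φ (m + v) Complex.I + fderiv ℝ φ (m - v) Complex.I - 2 * fderiv ℝ φ m Complex.I‖
        ≤ C * ‖v‖ ^ 2 := by
  intro φ hφ hφc
  have hφd : Differentiable ℝ φ := hφ.differentiable (by simp)
  have hD1s : ContDiff ℝ ∞ (fderiv ℝ φ) := (contDiff_infty_iff_fderiv.1 hφ).2
  have hD1d : Differentiable ℝ (fderiv ℝ φ) := hD1s.differentiable (by simp)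
  have hD2s : ContDiff ℝ ∞ (fderiv ℝ (fderiv ℝ φ)) := (contDiff_infty_iff_fderiv.1 hD1s).2
  have hD2c : HasCompactSupport (fderiv ℝ (fderiv ℝ φ)) := (hφc.fderiv ℝ).fderiv ℝ
  -- the type ascription keeps the instance unification cheap (operator-norm structures)
  obtain ⟨K, hK⟩ : ∃ K, LipschitzWith K (fderiv ℝ (fderiv ℝ φ)) :=
    ContDiff.lipschitzWith_of_hasCompactSupport hD2c hD2s (by simp)
  have key : ∀ m w : ℂ, ‖fderiv ℝ φ (m + w) + fderiv ℝ φ (m - w)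
      - (fderiv ℝ φ m + fderiv ℝ φ m)‖ ≤ 2 * K * ‖w‖ ^ 2 :=
    norm_second_difference_le hD1d hK
  have hK0 : (0 : ℝ) ≤ 2 * K := by positivity
  refine ⟨2 * K, fun m v _hv => ⟨?_, ?_, ?_⟩⟩
  · rw [two_mul (fderiv ℝ φ m v)]
    exact norm_odd_part_le hφd hK0 key m v
  · exact norm_apply_le_of_opNorm_le (key m v) (by positivity) 1 (by simp)
  · exact norm_apply_le_of_opNorm_le (key m v) (by positivity) Complex.I (by simp)

end Summit.CriticalPhenomena.CardyFormulaZ2.Theorems.WeakHolomorphy.SplitBypass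

end
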